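import Literature.AnabelianGeometry.EtaleTheta.Discharge.Sec2Prop22iiOfCoverData

/-!
# [EtTh] Proposition 2.2 (iii) over the BARE interface `CoverData` (proof-only companion)

Mochizuki, *The Étale Theta Function …* [EtTh], Publ. RIMS **45** (2009), §2, Prop. 2.2 (iii) and its
proof, PRIMS printed pp. 263–264 (= PDF pp. 37–38; kurims-ms pp. 34–35); bib key `MochizukiEtTh2009`.
PROOF-ONLY companion (no `def`, no new named fact, nothing restated) of `ThetaCovers.lean` (abc-iut-L2-t2,
p405102), sequel to `Sec2Prop22iiOfCoverData.lean` (p431949). Cell abc-iut, block C / W6, node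
`EtTh:Prop2.2(iii)`, FACT-LIST row F-0598 `CoverData.Prop22_iii` (seat abc-iut-w6-d082).
Before this file `CoverData.Prop22_iii` was DISCHARGED over the richer `CoverDataAx` only
(`CoverDataAx.prop22_iii_holds`, `Sec2DoubleCoverProofs.lean`, abc-iut-L2-t10; F-0598 "model-witnessed").
That discharge uses the supplementary axioms `pow_mem_barKer` ("`Δ̄_X` has exponent `l`") and `inv_theta`
("an inversion acts by `+1` on `Δ̄_Θ`") only at elements of the `Δ̄_Θ`-preimage and of the
`(−1)`-eigenspace `E`, where they FOLLOW from the bare interface: `[Δ̄_Θ-preimage : Ker] = l` (field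
`relIndex_barKer`) and `[E : Ker] = l` (`CoverData.relIndex_barKer_eigen`) are ODD, so `t ^ l ∈ Ker`
(`Subgroup.pow_relIndex_mem`) and "`t² ∈ Ker ⇒ t ∈ Ker`" hold there; and "`ι̲` acts by `+1` on `Δ̄_Θ`" for
THE inversion `ι̲` of the datum is the field `IsMinusEigen.plus`. Hence the UNIVERSAL CLOSURE
`CoverData.prop22_iii_holds : ∀ X : CoverData l, X.Prop22_iii` (F-0598 PROVED over the bare interface),
via bare-interface forms of abc-iut-L2-t10's lemmas. Nothing here asserts that `CoverData` is inhabited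
by an actual curve; no side is taken on [IUTchIII] Cor. 3.12; typed ≠ proved elsewhere.
-/

namespace Literature.AnabelianGeometry.EtaleTheta.ThetaCovers.CoverData

universe u

variable {l : ℕ} (X : CoverData.{u} l)

/-! ## Odd-index bookkeeping replacing the `CoverDataAx` axioms `pow_mem_barKer`, `inv_theta` -/

/-- If `t² ∈ K` and `t ^ n ∈ K` for an odd `n`, then `t ∈ K`. [cite: MochizukiEtTh2009, Prop 2.2(iii) p.37] -/
theorem mem_of_sq_mem_of_odd_pow_mem {G : Type*} [Group G] {K : Subgroup G} {t : G} {n : ℕ}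
    (hn : Odd n) (h2 : t * t ∈ K) (hn' : t ^ n ∈ K) : t ∈ K := by
  obtain ⟨m, rfl⟩ := hn
  have h2m : t ^ (2 * m) ∈ K := by rw [pow_mul, pow_two]; exact K.pow_mem h2 m
  have : t = (t ^ (2 * m))⁻¹ * t ^ (2 * m + 1) := by rw [pow_succ]; group
  rw [this]
  exact K.mul_mem (K.inv_mem h2m) hn'

/-- `t ^ l ∈ Ker(Δ_X ↠ Δ̄_X)` for `t` in the `Δ̄_Θ`-preimage (`#Δ̄_Θ = l`). [cite: MochizukiEtTh2009, Def 2.1 p.35] -/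
theorem pow_mem_barKer_of_mem_barTheta {t : X.PiC} (ht : t ∈ X.barTheta) : t ^ l ∈ X.barKer := by
  haveI := X.barKer_normal
  have h := Subgroup.pow_relIndex_mem X.barKer ht
  rwa [X.relIndex_barKer] at h

/-- `t² ∈ Ker ⇒ t ∈ Ker` on the `Δ̄_Θ`-preimage (`#Δ̄_Θ = l` odd). [cite: MochizukiEtTh2009, Prop 2.2(iii) p.37] -/
theorem mem_barKer_of_sq_mem_of_mem_barTheta {t : X.PiC} (ht : t ∈ X.barTheta)
    (h2 : t * t ∈ X.barKer) : t ∈ X.barKer :=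
  mem_of_sq_mem_of_odd_pow_mem X.l_odd h2 (X.pow_mem_barKer_of_mem_barTheta ht)

/-- An element of the `(−1)`-eigenspace `E` whose square lies in `Ker` lies in `Ker` (`#(E/Ker) = l` is
odd, `relIndex_barKer_eigen`). [cite: MochizukiEtTh2009, Prop 2.2(iii) p.37] -/
theorem mem_barKer_of_sq_mem_of_mem_eigen {H H' E : Subgroup X.PiC} {ι : X.PiC}
    (hH' : X.IsTypeLTorsPm H') (hH : H = H' ⊓ X.PiX) (hE : X.IsMinusEigen H H' ι E)
    {e : X.PiC} (he : e ∈ E) (h2 : e * e ∈ X.barKer) : e ∈ X.barKer := by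
  haveI := X.barKer_normal
  have h := Subgroup.pow_relIndex_mem X.barKer he
  rw [X.relIndex_barKer_eigen hH' hH hE] at h
  exact mem_of_sq_mem_of_odd_pow_mem X.l_odd h2 h

/-! ## Proposition 2.2 (iii): inversions of order `2` in `Δ̄_C̲`, over `CoverData` -/

/-- The square of an inversion lies in the `Δ̄_Θ`-preimage, over the bare interface (`ι̲² = e·t` is fixed
by `ι̲`, which inverts `e` mod `Ker`; `#(E/Ker) = l` odd). [cite: MochizukiEtTh2009, Prop 2.2(iii) p.37] -/
theorem inversion_sq_mem_barTheta {H H' E : Subgroup X.PiC} {ι : X.PiC}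
    (hH' : X.IsTypeLTorsPm H') (hH : H = H' ⊓ X.PiX) (hι : X.IsInversion H' ι)
    (hE : X.IsMinusEigen H H' ι E) : ι * ι ∈ X.barTheta := by
  haveI := X.barTheta_normal
  haveI := X.barKer_normal
  let π : X.PiC →* X.PiC ⧸ X.barKer := QuotientGroup.mk' X.barKer
  have hπ : ∀ x, π x = 1 ↔ x ∈ X.barKer := fun x => QuotientGroup.eq_one_iff x
  have hι2 : ι * ι ∈ H ⊓ X.DeltaC := by
    refine ⟨?_, X.aug.ker.mul_mem hι.mem_delta hι.mem_delta⟩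
    rw [hH]
    exact ⟨H'.mul_mem hι.mem hι.mem,
      (Subgroup.mul_mem_iff_of_index_two X.index_PiX).mpr Iff.rfl⟩
  rw [← hE.sup_eq] at hι2
  obtain ⟨e, he, t, ht, het⟩ := Subgroup.mem_sup_of_normal_right.mp hι2
  have hπ4 : ∀ a b c d : X.PiC, a * b * c⁻¹ * d ∈ X.barKer ↔ π a * π b * (π c)⁻¹ * π d = 1 := by
    intro a b c d
    rw [← hπ, map_mul, map_mul, map_mul, map_inv]
  have hem : π ι * π e * (π ι)⁻¹ = (π e)⁻¹ := by
    rw [← mul_eq_one_iff_eq_inv, ← hπ4]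
    exact hE.minus e he
  have htp : π ι * π t * (π ι)⁻¹ = π t := by
    have h := (hπ4 ι t ι t⁻¹).mp (hE.plus t ht)
    rwa [map_inv, mul_inv_eq_one] at h
  have hfix : π ι * (π e * π t) * (π ι)⁻¹ = π e * π t := by
    rw [← map_mul, het, map_mul]
    group
  have he2 : π e * π e = 1 := by
    have h1 : π e * π t = (π e)⁻¹ * π t := by
      calc π e * π t = π ι * (π e * π t) * (π ι)⁻¹ := hfix.symm
        _ = (π ι * π e * (π ι)⁻¹) * (π ι * π t * (π ι)⁻¹) := by group
        _ = (π e)⁻¹ * π t := by rw [hem, htp]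
    have h2 : π e = (π e)⁻¹ := mul_right_cancel h1
    calc π e * π e = (π e)⁻¹ * π e := by rw [← h2]
      _ = 1 := inv_mul_cancel _
  have heK : e ∈ X.barKer := by
    refine X.mem_barKer_of_sq_mem_of_mem_eigen hH' hH hE he ?_
    rw [← hπ, map_mul]; exact he2
  rw [← het]
  exact X.barTheta.mul_mem (X.barKer_le_barTheta heK) ht

/-- **Prop 2.2 (iii), first sentence ("order `2`" read in `Δ̄_C̲`)**, over the bare interface: an inversion
`ι₀` with `ι₀² ∈ Ker` exists, and an inversion `ι₁` has `ι₁² ∈ Ker ↔ ι₀⁻¹ ι₁ ∈ E` ("a unique coset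
`∈ Δ_C̲/Δ_X̲̲` such that `ι̲` has order `2` iff it belongs to this coset"). [cite: MochizukiEtTh2009, Prop 2.2(iii) p.37] -/
theorem exists_inversion_sq_mem_barKer {H H' E : Subgroup X.PiC} {ι : X.PiC}
    (hH' : X.IsTypeLTorsPm H') (hH : H = H' ⊓ X.PiX) (hι : X.IsInversion H' ι)
    (hE : X.IsMinusEigen H H' ι E) :
    ∃ ι₀ : X.PiC, X.IsInversion H' ι₀ ∧ ι₀ * ι₀ ∈ X.barKer ∧
      ∀ ι₁ : X.PiC, X.IsInversion H' ι₁ → (ι₁ * ι₁ ∈ X.barKer ↔ ι₀⁻¹ * ι₁ ∈ E) := by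
  classical
  haveI := X.PiX_normal
  haveI := X.barTheta_normal
  haveI := X.barKer_normal
  have hT : X.IsTypeLTors H := by rw [hH]; exact hH'.inf_isTypeLTors
  obtain ⟨m, hm⟩ := X.l_odd
  have hHX : H ≤ X.PiX := hT.le
  have hTH' : X.barTheta ≤ H' := fun t ht => by
    have := hT.barTheta_le ht; rw [hH] at this; exact this.1
  have hTΔ : X.barTheta ≤ X.DeltaX := X.barTheta_le
  have hιC : ι ∈ X.aug.ker := hι.mem_delta
  have hιX : ι ∉ X.PiX := hι.not_mem
  let π : X.PiC →* X.PiC ⧸ X.barKer := QuotientGroup.mk' X.barKer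
  have hπ : ∀ x, π x = 1 ↔ x ∈ X.barKer := fun x => QuotientGroup.eq_one_iff x
  have hπ4 : ∀ a b c d : X.PiC, a * b * c⁻¹ * d ∈ X.barKer ↔ π a * π b * (π c)⁻¹ * π d = 1 := by
    intro a b c d
    rw [← hπ, map_mul, map_mul, map_mul, map_inv]
  have hcomm4 : ∀ a b : X.PiC, a * b * a⁻¹ * b⁻¹ ∈ X.barKer → Commute (π a) (π b) := by
    intro a b h
    have h1 : π a * π b * (π a)⁻¹ * π b⁻¹ = 1 := (hπ4 a b a b⁻¹).mp h
    rw [map_inv] at h1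
    change π a * π b = π b * π a
    calc π a * π b = (π a * π b * (π a)⁻¹ * (π b)⁻¹) * (π b * π a) := by group
      _ = π b * π a := by rw [h1, one_mul]
  have hcen : ∀ t ∈ X.barTheta, ∀ x ∈ X.DeltaX, Commute (π t) (π x) :=
    fun t ht x hx => hcomm4 t x (X.barTheta_central t ht x hx)
  have hplus : ∀ t ∈ X.barTheta, Commute (π ι) (π t) :=
    fun t ht => hcomm4 ι t (hE.plus t ht)
  have hminus : ∀ e ∈ E, π ι * π e * (π ι)⁻¹ = (π e)⁻¹ := by
    intro e he
    rw [← mul_eq_one_iff_eq_inv, ← hπ4]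
    exact hE.minus e he
  have h2T : ι * ι ∈ X.barTheta := X.inversion_sq_mem_barTheta hH' hH hι hE
  set t₁ := (ι * ι) ^ m with ht₁_def
  have ht₁ : t₁ ∈ X.barTheta := X.barTheta.pow_mem h2T m
  have h00 : ι * t₁ * (ι * t₁) ∈ X.barKer := by
    rw [← hπ, map_mul, map_mul, ht₁_def, map_pow, map_mul]
    have hl : (π ι * π ι) ^ l = 1 := by
      rw [← map_mul, ← map_pow, hπ]; exact X.pow_mem_barKer_of_mem_barTheta h2T
    have hc : Commute (π ι) ((π ι * π ι) ^ m) :=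
      ((Commute.refl (π ι)).mul_right (Commute.refl (π ι))).pow_right m
    have h1 : π ι * (π ι * π ι) ^ m * (π ι * (π ι * π ι) ^ m) =
        (π ι * π ι) * ((π ι * π ι) ^ m * (π ι * π ι) ^ m) := by
      rw [mul_assoc (π ι) ((π ι * π ι) ^ m) (π ι * (π ι * π ι) ^ m),
        ← mul_assoc ((π ι * π ι) ^ m) (π ι) ((π ι * π ι) ^ m), ← hc.eq,
        mul_assoc (π ι) ((π ι * π ι) ^ m) ((π ι * π ι) ^ m), ← mul_assoc]
    rw [h1, ← pow_add, ← pow_succ', show m + m + 1 = l by omega, hl]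
  have hι₀X : ι * t₁ ∉ X.PiX := fun h =>
    hιX ((Subgroup.mul_mem_cancel_right X.PiX (hTΔ ht₁).1).mp h)
  refine ⟨ι * t₁, ⟨H'.mul_mem hι.mem (hTH' ht₁), X.aug.ker.mul_mem hιC (hTΔ ht₁).2, hι₀X⟩,
    h00, fun ι₁ hι₁ => ?_⟩
  have hx : (ι * t₁)⁻¹ * ι₁ ∈ H ⊓ X.DeltaC := by
    refine ⟨?_, X.aug.ker.mul_mem (X.aug.ker.inv_mem (X.aug.ker.mul_mem hιC (hTΔ ht₁).2))
      hι₁.mem_delta⟩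
    rw [hH]
    refine ⟨H'.mul_mem (H'.inv_mem (H'.mul_mem hι.mem (hTH' ht₁))) hι₁.mem, ?_⟩
    have h0 : (ι * t₁)⁻¹ ∉ X.PiX := fun h => hι₀X (inv_mem_iff.mp h)
    exact (Subgroup.mul_mem_iff_of_index_two X.index_PiX).mpr
      ⟨fun h => absurd h h0, fun h => absurd h hι₁.not_mem⟩
  have hx' : (ι * t₁)⁻¹ * ι₁ ∈ E ⊔ X.barTheta := by rw [hE.sup_eq]; exact hx
  obtain ⟨e, he, t, ht, het⟩ := Subgroup.mem_sup_of_normal_right.mp hx'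
  have heΔ : e ∈ X.DeltaX := ⟨hHX (hE.le he).1, (hE.le he).2⟩
  have hι₁eq : ι₁ = ι * t₁ * (e * t) := by rw [het]; group
  have hAB : Commute (π t₁) (π e) := hcen t₁ ht₁ e heΔ
  have hAC : Commute (π t₁) (π t) := hcen t₁ ht₁ t (hTΔ ht)
  have hBC : Commute (π e) (π t) := (hcen t ht e heΔ).symm
  have hIC : Commute (π ι) (π t) := hplus t ht
  have h00' : π ι * π t₁ * (π ι * π t₁) = 1 := by
    rw [← map_mul, ← map_mul, hπ]; exact h00
  have hIAB : π ι * π t₁ * π e * (π ι * π t₁)⁻¹ = (π e)⁻¹ := by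
    calc π ι * π t₁ * π e * (π ι * π t₁)⁻¹ = π ι * (π t₁ * π e * (π t₁)⁻¹) * (π ι)⁻¹ := by group
      _ = π ι * π e * (π ι)⁻¹ := by rw [hAB.eq, mul_inv_cancel_right]
      _ = (π e)⁻¹ := hminus e he
  have hIAC : π ι * π t₁ * π t * (π ι * π t₁)⁻¹ = π t := by
    calc π ι * π t₁ * π t * (π ι * π t₁)⁻¹ = π ι * (π t₁ * π t * (π t₁)⁻¹) * (π ι)⁻¹ := by group
      _ = π ι * π t * (π ι)⁻¹ := by rw [hAC.eq, mul_inv_cancel_right]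
      _ = π t := by rw [hIC.eq, mul_inv_cancel_right]
  have key : π (ι₁ * ι₁) = π t * π t := by
    rw [hι₁eq]
    simp only [map_mul]
    calc π ι * π t₁ * (π e * π t) * (π ι * π t₁ * (π e * π t))
        = (π ι * π t₁ * π e * (π ι * π t₁)⁻¹) * (π ι * π t₁ * π t * (π ι * π t₁)⁻¹) *
            (π ι * π t₁ * (π ι * π t₁)) * (π e * π t) := by group
      _ = (π e)⁻¹ * π t * 1 * (π e * π t) := by rw [hIAB, hIAC, h00']
      _ = (π e)⁻¹ * (π t * π e) * π t := by group
      _ = (π e)⁻¹ * (π e * π t) * π t := by rw [← hBC.eq]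
      _ = π t * π t := by group
  have hι₁sq : ι₁ * ι₁ ∈ X.barKer ↔ t * t ∈ X.barKer := by
    rw [← hπ, ← hπ, key, map_mul]
  constructor
  · intro h1
    have htK : t ∈ X.barKer := X.mem_barKer_of_sq_mem_of_mem_barTheta ht (hι₁sq.mp h1)
    rw [← het]
    exact E.mul_mem he (hE.barKer_le htK)
  · intro h1
    rw [← het] at h1
    have htE : t ∈ E := by simpa using E.mul_mem (E.inv_mem he) h1
    have htK : t ∈ X.barKer := by rw [← hE.inf_eq]; exact ⟨htE, ht⟩
    exact hι₁sq.mpr (X.barKer.mul_mem htK htK)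

/-- An element `c ∈ Δ_X̲` on which the inversion acts by `−1` modulo `Ker` lies in the
`(−1)`-eigenspace `E`, over the bare interface (write `c = e·t`; `ι̲` fixes `t` and inverts `e` and `c`
modulo `Ker`, so `t² ∈ Ker`; `#Δ̄_Θ = l` odd). [cite: MochizukiEtTh2009, Prop 2.2(i) p.37] -/
theorem minus_mem_eigen {H H' E : Subgroup X.PiC} {ι : X.PiC}
    (hH' : X.IsTypeLTorsPm H') (hH : H = H' ⊓ X.PiX) (hE : X.IsMinusEigen H H' ι E) {c : X.PiC}
    (hc : c ∈ H ⊓ X.DeltaC) (hcm : ι * c * ι⁻¹ * c ∈ X.barKer) : c ∈ E := by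
  haveI := X.barTheta_normal
  haveI := X.barKer_normal
  have hT : X.IsTypeLTors H := by rw [hH]; exact hH'.inf_isTypeLTors
  have hHX : H ≤ X.PiX := hT.le
  let π : X.PiC →* X.PiC ⧸ X.barKer := QuotientGroup.mk' X.barKer
  have hπ : ∀ x, π x = 1 ↔ x ∈ X.barKer := fun x => QuotientGroup.eq_one_iff x
  have hπ4 : ∀ a b c d : X.PiC, a * b * c⁻¹ * d ∈ X.barKer ↔ π a * π b * (π c)⁻¹ * π d = 1 := by
    intro a b c d
    rw [← hπ, map_mul, map_mul, map_mul, map_inv]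
  have hc' : c ∈ E ⊔ X.barTheta := by rw [hE.sup_eq]; exact hc
  obtain ⟨e, he, t, ht, rfl⟩ := Subgroup.mem_sup_of_normal_right.mp hc'
  have heΔ : e ∈ X.DeltaX := ⟨hHX (hE.le he).1, (hE.le he).2⟩
  have hem : π ι * π e * (π ι)⁻¹ = (π e)⁻¹ := by
    rw [← mul_eq_one_iff_eq_inv, ← hπ4]; exact hE.minus e he
  have htp : π ι * π t * (π ι)⁻¹ = π t := by
    have h := (hπ4 ι t ι t⁻¹).mp (hE.plus t ht)
    rwa [map_inv, mul_inv_eq_one] at h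
  have hcm' : π ι * (π e * π t) * (π ι)⁻¹ = (π e * π t)⁻¹ := by
    rw [← mul_eq_one_iff_eq_inv, ← map_mul, ← hπ4]; exact hcm
  have hET : Commute (π e) (π t) := by
    have h1 : π t * π e * (π t)⁻¹ * π e⁻¹ = 1 :=
      (hπ4 t e t e⁻¹).mp (X.barTheta_central t ht e heΔ)
    rw [map_inv] at h1
    change π e * π t = π t * π e
    calc π e * π t = (π t * π e * (π t)⁻¹ * (π e)⁻¹)⁻¹ * (π t * π e) := by group
      _ = π t * π e := by rw [h1, inv_one, one_mul]
  have h2 : π t * π t = 1 := by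
    have h1 : (π e)⁻¹ * π t = (π e)⁻¹ * (π t)⁻¹ := by
      calc (π e)⁻¹ * π t = (π ι * π e * (π ι)⁻¹) * (π ι * π t * (π ι)⁻¹) := by rw [hem, htp]
        _ = π ι * (π e * π t) * (π ι)⁻¹ := by group
        _ = (π e * π t)⁻¹ := hcm'
        _ = (π t * π e)⁻¹ := by rw [hET.eq]
        _ = (π e)⁻¹ * (π t)⁻¹ := mul_inv_rev _ _
    have h3 : π t = (π t)⁻¹ := mul_left_cancel h1
    nth_rw 1 [h3]
    exact inv_mul_cancel _
  have htK : t ∈ X.barKer := by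
    refine X.mem_barKer_of_sq_mem_of_mem_barTheta ht ?_
    rw [← hπ, map_mul]; exact h2
  exact E.mul_mem he (hE.barKer_le htK)

/-- An inversion `ι̲` with `ι̲² ∈ Ker(Δ_X ↠ Δ̄_X)` normalises `Π_X̲̲ = S · E`, over the bare interface
(proof of Prop 2.2 (iii), p.38: "`ι̲` normalizes `D_x ≅ Π_X̲/Δ_X̲̲` … conjugation by `ι̲` induces the
identity on `Δ̄_Θ` and `G_K`"): the commutator `[ι̲, s]`, `s ∈ S`, lies in `Δ_X̲` and is inverted by `ι̲`
modulo `Ker`, hence lies in `E`. [cite: MochizukiEtTh2009, Prop 2.2(iii) p.37] -/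
theorem inversion_conj_mem_sup {H H' E S : Subgroup X.PiC} {ι : X.PiC}
    (hH' : X.IsTypeLTorsPm H') (hH : H = H' ⊓ X.PiX) (hι : X.IsInversion H' ι)
    (hE : X.IsMinusEigen H H' ι E) (hS : X.IsSplitting S) (h2 : ι * ι ∈ X.barKer) {p : X.PiC}
    (hp : p ∈ S ⊔ E) : ι * p * ι⁻¹ ∈ S ⊔ E := by
  haveI := X.PiX_normal
  haveI := X.barKer_normal
  have hT : X.IsTypeLTors H := by rw [hH]; exact hH'.inf_isTypeLTors
  have hHX : H ≤ X.PiX := hT.le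
  have hSle : S ≤ H :=
    hS.le.trans (sup_le hT.Dx_le (X.barKer_le_barTheta.trans hT.barTheta_le))
  have hEle : E ≤ H := hE.le.trans inf_le_left
  have hιC : X.aug ι = 1 := hι.mem_delta
  have hHH' : H ≤ H' := by rw [hH]; exact inf_le_left
  have hH'X : ∀ x, x ∈ H' → x ∈ X.PiX → x ∈ H := by intro x h1 h2; rw [hH]; exact ⟨h1, h2⟩
  haveI : (E.subgroupOf H).Normal :=
    (Subgroup.normal_subgroupOf_iff hEle).mpr fun e g he hg => hE.conj_mem g hg e he
  have hp' : (⟨p, sup_le hSle hEle hp⟩ : H) ∈ S.subgroupOf H ⊔ E.subgroupOf H := by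
    rw [← Subgroup.subgroupOf_sup hSle hEle, Subgroup.mem_subgroupOf]; exact hp
  obtain ⟨y, hy, z, hz, hyz⟩ := Subgroup.mem_sup_of_normal_right.mp hp'
  rw [Subgroup.mem_subgroupOf] at hy hz
  have hxyz : (y : X.PiC) * z = p := congrArg Subtype.val hyz
  have hyH' : (y : X.PiC) ∈ H' := hHH' (hSle hy)
  have hc : ι * y * ι⁻¹ * (y : X.PiC)⁻¹ ∈ H ⊓ X.DeltaC := by
    refine ⟨?_, ?_⟩
    · exact hH'X _ (H'.mul_mem (H'.mul_mem (H'.mul_mem hι.mem hyH') (H'.inv_mem hι.mem))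
          (H'.inv_mem hyH'))
        (X.PiX.mul_mem (X.PiX_normal.conj_mem _ (hHX (hSle hy)) ι) (X.PiX.inv_mem (hHX (hSle hy))))
    · change X.aug (ι * y * ι⁻¹ * (y : X.PiC)⁻¹) = 1
      rw [map_mul, map_mul, map_mul, map_inv, map_inv, hιC]
      simp
  have hcm : ι * (ι * y * ι⁻¹ * (y : X.PiC)⁻¹) * ι⁻¹ * (ι * y * ι⁻¹ * (y : X.PiC)⁻¹) ∈ X.barKer := by
    have : ι * (ι * y * ι⁻¹ * (y : X.PiC)⁻¹) * ι⁻¹ * (ι * y * ι⁻¹ * (y : X.PiC)⁻¹) =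
        (ι * ι) * (y * (ι * ι)⁻¹ * (y : X.PiC)⁻¹) := by group
    rw [this]
    exact X.barKer.mul_mem h2 (X.barKer_normal.conj_mem _ (X.barKer.inv_mem h2) y)
  have hcE : ι * y * ι⁻¹ * (y : X.PiC)⁻¹ ∈ E := X.minus_mem_eigen hH' hH hE hc hcm
  have : ι * p * ι⁻¹ = (ι * y * ι⁻¹ * (y : X.PiC)⁻¹) * y * (ι * z * ι⁻¹) := by
    rw [← hxyz]; group
  rw [this]
  exact Subgroup.mul_mem _ (Subgroup.mul_mem _ (Subgroup.mem_sup_right hcE)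
    (Subgroup.mem_sup_left hy)) (Subgroup.mem_sup_right (hE.iota_conj z hz))

/-- Elements of `⟨Π_X̲̲, ι̲⟩ = Π_X̲̲ · ⟨ι̲⟩` are `p` or `p·ι̲` with `p ∈ Π_X̲̲`, over the bare interface (`ι̲`
normalises `Π_X̲̲`, `ι̲² ∈ Ker ⊆ Π_X̲̲`). [cite: MochizukiEtTh2009, Prop 2.2(iii) p.37] -/
theorem mem_sup_zpowers_iff {H H' E S : Subgroup X.PiC} {ι : X.PiC}
    (hH' : X.IsTypeLTorsPm H') (hH : H = H' ⊓ X.PiX) (hι : X.IsInversion H' ι)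
    (hE : X.IsMinusEigen H H' ι E) (hS : X.IsSplitting S) (h2 : ι * ι ∈ X.barKer) {x : X.PiC} :
    x ∈ (S ⊔ E) ⊔ Subgroup.zpowers ι ↔ x ∈ S ⊔ E ∨ ∃ p ∈ S ⊔ E, x = p * ι := by
  have hι2 : ι * ι ∈ S ⊔ E := Subgroup.mem_sup_right (hE.barKer_le h2)
  have hconj : ∀ p ∈ S ⊔ E, ι * p * ι⁻¹ ∈ S ⊔ E :=
    fun p hp => X.inversion_conj_mem_sup hH' hH hι hE hS h2 hp
  constructor
  · intro hx
    let M : Subgroup X.PiC :=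
      { carrier := {x | x ∈ S ⊔ E ∨ ∃ p ∈ S ⊔ E, x = p * ι}
        mul_mem' := by
          rintro a b (ha | ⟨p, hp, rfl⟩) (hb | ⟨q, hq, rfl⟩)
          · exact Or.inl (Subgroup.mul_mem _ ha hb)
          · exact Or.inr ⟨a * q, Subgroup.mul_mem _ ha hq, by group⟩
          · refine Or.inr ⟨p * (ι * b * ι⁻¹), Subgroup.mul_mem _ hp (hconj b hb), by group⟩
          · refine Or.inl ?_
            have : p * ι * (q * ι) = p * (ι * q * ι⁻¹) * (ι * ι) := by group
            rw [this]
            exact Subgroup.mul_mem _ (Subgroup.mul_mem _ hp (hconj q hq)) hι2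
        one_mem' := Or.inl (Subgroup.one_mem _)
        inv_mem' := by
          rintro a (ha | ⟨p, hp, rfl⟩)
          · exact Or.inl (Subgroup.inv_mem _ ha)
          · refine Or.inr ⟨(ι * ι)⁻¹ * (ι * p⁻¹ * ι⁻¹), Subgroup.mul_mem _ (Subgroup.inv_mem _ hι2)
              (hconj p⁻¹ (Subgroup.inv_mem _ hp)), by group⟩ }
    have hle : (S ⊔ E) ⊔ Subgroup.zpowers ι ≤ M := by
      refine sup_le (fun p hp => Or.inl hp) ?_
      rw [Subgroup.zpowers_le]
      exact Or.inr ⟨1, Subgroup.one_mem _, by group⟩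
    exact hle hx
  · rintro (hx | ⟨p, hp, rfl⟩)
    · exact Subgroup.mem_sup_left hx
    · exact Subgroup.mul_mem _ (Subgroup.mem_sup_left hp)
        (Subgroup.mem_sup_right (Subgroup.mem_zpowers ι))

/-- **Prop 2.2 (iii), second sentence — the cartesian square**, over the bare interface:
`⟨Π_X̲̲, ι̲⟩ ∩ Π_X̲ = Π_X̲̲` for an inversion `ι̲` of order `2` in `Δ̄_C̲`.
[cite: MochizukiEtTh2009, Prop 2.2(iii) p.37] -/
theorem sup_zpowers_inf_eq {H H' E S : Subgroup X.PiC} {ι : X.PiC}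
    (hH' : X.IsTypeLTorsPm H') (hH : H = H' ⊓ X.PiX) (hι : X.IsInversion H' ι)
    (hE : X.IsMinusEigen H H' ι E) (hS : X.IsSplitting S) (h2 : ι * ι ∈ X.barKer) :
    ((S ⊔ E) ⊔ Subgroup.zpowers ι) ⊓ H = S ⊔ E := by
  have hT : X.IsTypeLTors H := by rw [hH]; exact hH'.inf_isTypeLTors
  have hHX : H ≤ X.PiX := hT.le
  have hSle : S ≤ H :=
    hS.le.trans (sup_le hT.Dx_le (X.barKer_le_barTheta.trans hT.barTheta_le))
  have hEle : E ≤ H := hE.le.trans inf_le_left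
  refine le_antisymm ?_ (le_inf le_sup_left (sup_le hSle hEle))
  rintro x ⟨hx, hxH⟩
  rcases (X.mem_sup_zpowers_iff hH' hH hι hE hS h2).mp hx with hx' | ⟨p, hp, rfl⟩
  · exact hx'
  · exact absurd ((Subgroup.mul_mem_cancel_left X.PiX (hHX (sup_le hSle hEle hp))).mp (hHX hxH))
      hι.not_mem

/-- **Prop 2.2 (iii), second sentence — the double covering `X̲̲ → C̲̲`**, over the bare interface:
`[⟨Π_X̲̲, ι̲⟩ : Π_X̲̲] = 2`. [cite: MochizukiEtTh2009, Prop 2.2(iii) p.37] -/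
theorem relIndex_sup_zpowers {H H' E S : Subgroup X.PiC} {ι : X.PiC}
    (hH' : X.IsTypeLTorsPm H') (hH : H = H' ⊓ X.PiX) (hι : X.IsInversion H' ι)
    (hE : X.IsMinusEigen H H' ι E) (hS : X.IsSplitting S) (h2 : ι * ι ∈ X.barKer) :
    (S ⊔ E).relIndex ((S ⊔ E) ⊔ Subgroup.zpowers ι) = 2 := by
  have hT : X.IsTypeLTors H := by rw [hH]; exact hH'.inf_isTypeLTors
  have hHX : H ≤ X.PiX := hT.le
  have hSle : S ≤ H :=
    hS.le.trans (sup_le hT.Dx_le (X.barKer_le_barTheta.trans hT.barTheta_le))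
  have hEle : E ≤ H := hE.le.trans inf_le_left
  have hPX : S ⊔ E ≤ X.PiX := (sup_le hSle hEle).trans hHX
  have hι2 : ι * ι ∈ S ⊔ E := Subgroup.mem_sup_right (hE.barKer_le h2)
  have hιP : ι ∉ S ⊔ E := fun h => hι.not_mem (hPX h)
  rw [Subgroup.relIndex_eq_two_iff]
  refine ⟨ι, Subgroup.mem_sup_right (Subgroup.mem_zpowers ι), fun b hb => ?_⟩
  rcases (X.mem_sup_zpowers_iff hH' hH hι hE hS h2).mp hb with hb' | ⟨p, hp, rfl⟩
  · refine Or.inr ⟨hb', fun h => hιP ?_⟩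
    exact (Subgroup.mul_mem_cancel_left (S ⊔ E) hb').mp h
  · refine Or.inl ⟨?_, fun h => hιP ((Subgroup.mul_mem_cancel_left (S ⊔ E) hp).mp h)⟩
    have : p * ι * ι = p * (ι * ι) := by group
    rw [this]
    exact Subgroup.mul_mem _ hp hι2

/-- **[EtTh] Proposition 2.2 (iii) — the named fact `CoverData.Prop22_iii` (F-0598) PROVED over the
bare interface `CoverData`** (universal closure: every `X : CoverData l`; order `2` read in `Δ̄_C̲`).
[cite: MochizukiEtTh2009, Prop 2.2(iii) p.37] -/
theorem prop22_iii_holds :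
    Literature.AnabelianGeometry.EtaleTheta.ThetaCovers.CoverData.Prop22_iii X := by
  intro H H' E S ι hH' hH hι hE hS
  exact ⟨X.exists_inversion_sq_mem_barKer hH' hH hι hE,
    fun h2 => ⟨X.sup_zpowers_inf_eq hH' hH hι hE hS h2, X.relIndex_sup_zpowers hH' hH hι hE hS h2⟩⟩

/-- `Prop22_iii` — `_holds` alias of `prop22_iii_holds` above under the fact's exact name (appended
2026-08-28, D-0026 bookkeeping: the proof term is the existing theorem of this file; no statement,
definition or attribute is edited; no new named fact; the ledger's debt table listed the fact
unproved). [cite: MochizukiEtTh2009, Prop 2.2(iii) p.37] -/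
theorem _root_.Literature.AnabelianGeometry.EtaleTheta.ThetaCovers.CoverData.Prop22_iii_holds :
    Literature.AnabelianGeometry.EtaleTheta.ThetaCovers.CoverData.Prop22_iii X :=
  _root_.Literature.AnabelianGeometry.EtaleTheta.ThetaCovers.CoverData.prop22_iii_holds (X := X)

end Literature.AnabelianGeometry.EtaleTheta.ThetaCovers.CoverData
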